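import Mathlib
import Summits.ValiantsHypothesis.ValiantsHypothesis.Theorems.RigidityForcesSymmetryRankRigidMinimalReprLaplaceFourFivePencilPlane
import Summits.ValiantsHypothesis.ValiantsHypothesis.Theorems.RigidityForcesSymmetryRankRigidMinimalReprLaplaceTriangular

/-!
# The `3 × 5` injective pattern has slice rank exactly five
# (crux `RankRigidMinimalRepr`, stmt-ValiantsHypothesis-18034; frontier rung `LaplaceOptimalFive`, stmt-24813)

The rectangular pattern `P₃,₅(v) = [v : Fin 3 → Fin 5 injective]` is a sum of five slices (Laplace along a slot) and — this file —
of no fewer: `slice_rank_three_five`.  In the data format of `LaplaceOptimal`: split-rank-one terms `u_t(v|_{S_t}) w_t(v|_{S_tᶜ})` with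
`|S_t| ∈ {1, 2}` (for three slots every proper split is a slice) summing to `[v injective]` on `Fin 3 → Fin 5` number at least `5`.
So the weighted rectangular count («LO(3,5)»: `Σ 1/rank ≥ 1`, all ranks `5`) HOLDS one letter up from `laplaceOptimal_three`, while two
letters up in the slots it FAILS (`LaplaceOptimalFourFive`, refuted by val-lit-p8 g12's weight-8 identity, item 27319).

Proof (the pencil method of `laplaceOptimal_four`, `…LaplaceFourFivePencil{,Plane}.lean`): put the slot carrying the most slices first
(slot transport); contracting it against a vector `x` orthogonal to those slice vectors turns the pattern into the `5 × 5` pencil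
`M(x)(b,c) = [b ≠ c](X - x_b - x_c)` and every other slice into a rank-one matrix.  With at most four terms, `M(x)` is a sum of at most
two rank-one matrices for all `x` in a subspace of dimension at least three: `M(x) = 0` forces `x = 0` (`pencil5_eq_zero`), one rank-one
forces `M(x) = 0` (`symm_rank_one_eq_zero'`), and two rank-one on a plane contradict `pencil5_plane_not_two_rank_one`.

HONEST FRAMING: an exact rectangular statement one level below the frontier rung `LaplaceOptimalFive` (stmt-24813, OPEN); nothing here
bears on `VP ≠ VNP`.
-/

set_option autoImplicit false

-- the mandated summit-side namespace repeats a component by design (single-problem summit)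
set_option linter.dupNamespace false

namespace Summit.ValiantsHypothesis.ValiantsHypothesis.Theorems.RigidityForcesSymmetryRankRigidMinimalRepr

namespace ThreeFive

open Finset

/-! ### §1 The pattern and its contraction -/

/-- A vector of three values is injective iff the values are pairwise distinct. -/
theorem injective_vec3_iff (a b c : Fin 5) :
    Function.Injective ![a, b, c] ↔ (a ≠ b ∧ a ≠ c ∧ b ≠ c) := by
  constructor
  · intro h
    refine ⟨fun e => ?_, fun e => ?_, fun e => ?_⟩
    · exact absurd (@h 0 1 (by simp [e])) (by decide)
    · exact absurd (@h 0 2 (by simp [e])) (by decide)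
    · exact absurd (@h 1 2 (by simp [e])) (by decide)
  · rintro ⟨h01, h02, h12⟩ i j hij
    fin_cases i <;> fin_cases j <;> first | rfl | (exfalso; simp_all)

/-- Contracting the first slot of the pattern against `x`: `Σ_a x_a [(a,b,c) injective] = [b ≠ c](X - x_b - x_c)` — the pencil. -/
theorem contract_pattern3 (x : Fin 5 → ℂ) (b c : Fin 5) :
    (∑ a, x a * (if Function.Injective ![a, b, c] then (1 : ℂ) else 0)) =
      if b = c then 0 else (∑ a, x a) - x b - x c := by
  by_cases hbc : b = c
  · rw [if_pos hbc]
    refine sum_eq_zero fun a _ => ?_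
    rw [if_neg (fun h => ((injective_vec3_iff a b c).mp h).2.2 hbc), mul_zero]
  · rw [if_neg hbc]
    have key : ∀ a, (x a * if Function.Injective ![a, b, c] then (1 : ℂ) else 0) =
        x a - (if a = b then x a else 0) - (if a = c then x a else 0) := by
      intro a
      by_cases hab : a = b
      · subst hab; simp [injective_vec3_iff, hbc]
      · by_cases hac : a = c
        · subst hac; simp [injective_vec3_iff, hab]
        · simp [injective_vec3_iff, hab, hac, hbc]
    simp only [key, sum_sub_distrib, sum_ite_eq', mem_univ, if_true]

/-! ### §2 Normal form of a term and the rank-one shape of a contracted slice -/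

/-- Every proper split term of a `3`-slot pattern is a slice `f(v_s) · G(v)` with `G` blind to the slot `s`. -/
theorem slice_normal_form3 (S : Finset (Fin 3)) (u w : (Fin 3 → Fin 5) → ℂ)
    (hu : ∀ v v' : Fin 3 → Fin 5, (∀ i ∈ S, v i = v' i) → u v = u v')
    (hw : ∀ v v' : Fin 3 → Fin 5, (∀ i, i ∉ S → v i = v' i) → w v = w v')
    (h : S.card = 1 ∨ S.card = 2) :
    ∃ (s : Fin 3) (f : Fin 5 → ℂ) (G : (Fin 3 → Fin 5) → ℂ),
      (∀ v v' : Fin 3 → Fin 5, (∀ j, j ≠ s → v j = v' j) → G v = G v') ∧ ∀ v, u v * w v = f (v s) * G v := by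
  classical
  rcases h with h | h
  · obtain ⟨s, hs⟩ := card_eq_one.mp h
    refine ⟨s, fun c => u (fun _ => c), w, fun v v' hvv' => hw v v' (fun i hi => hvv' i ?_), fun v => ?_⟩
    · rw [hs, mem_singleton] at hi; exact hi
    · rw [hu v (fun _ => v s) (fun i hi => by rw [hs, mem_singleton] at hi; rw [hi])]
  · have hc : Sᶜ.card = 1 := by rw [card_compl, h]; rfl
    obtain ⟨s, hs⟩ := card_eq_one.mp hc
    have hsS : s ∉ S := by rw [← mem_compl, hs]; exact mem_singleton_self s
    refine ⟨s, fun c => w (fun _ => c), u, fun v v' hvv' => hu v v' (fun i hi => hvv' i ?_), fun v => ?_⟩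
    · rintro rfl; exact hsS hi
    · rw [hw v (fun _ => v s) (fun i hi => by
        have : i ∈ Sᶜ := mem_compl.mpr hi
        rw [hs, mem_singleton] at this; rw [this]), mul_comm]

/-- A slice at a slot `s ≠ 0`, contracted at slot `0` against any `x`, is a rank-one matrix in the two remaining slots. -/
theorem contract_other_slice (x g : Fin 5 → ℂ) (H : (Fin 3 → Fin 5) → ℂ) (s : Fin 3) (hs : s ≠ 0)
    (hH : ∀ v v' : Fin 3 → Fin 5, (∀ j, j ≠ s → v j = v' j) → H v = H v') :
    ∃ p q : Fin 5 → ℂ, ∀ b c : Fin 5, (∑ a, x a * (g (![a, b, c] s) * H ![a, b, c])) = p b * q c := by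
  have hs' : s = 1 ∨ s = 2 := by
    fin_cases s
    · exact absurd rfl hs
    · exact Or.inl rfl
    · exact Or.inr rfl
  rcases hs' with rfl | rfl
  · -- slice at slot 1: `g(b) · Σ_a x_a H(a,·,c)`, `H` blind to slot 1
    refine ⟨g, fun c => ∑ a, x a * H ![a, 0, c], fun b c => ?_⟩
    rw [mul_sum]
    refine sum_congr rfl fun a _ => ?_
    have : H ![a, b, c] = H ![a, 0, c] := hH _ _ (fun j hj => by fin_cases j <;> simp_all)
    rw [show (![a, b, c] : Fin 3 → Fin 5) 1 = b from rfl, this]; ring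
  · -- slice at slot 2: `(Σ_a x_a H(a,b,·)) · g(c)`, `H` blind to slot 2
    refine ⟨fun b => ∑ a, x a * H ![a, b, 0], g, fun b c => ?_⟩
    rw [sum_mul]
    refine sum_congr rfl fun a _ => ?_
    have : H ![a, b, c] = H ![a, b, 0] := hH _ _ (fun j hj => by fin_cases j <;> simp_all)
    rw [show (![a, b, c] : Fin 3 → Fin 5) 2 = c from rfl, this]; ring

/-! ### §3 Kernels of few linear conditions on `ℂ⁵` -/

/-- At most two linear conditions on `ℂ⁵` leave a linearly independent pair of solutions. -/
theorem exists_indep_pair (F : Finset (Fin 5 → ℂ)) (hF : F.card ≤ 2) :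
    ∃ x x' : Fin 5 → ℂ, LinearIndependent ℂ ![x, x'] ∧ (∀ f ∈ F, ∑ c, x c * f c = 0) ∧ (∀ f ∈ F, ∑ c, x' c * f c = 0) := by
  classical
  let L : (Fin 5 → ℂ) →ₗ[ℂ] (F → ℂ) :=
    { toFun := fun φ a => ∑ c, φ c * (a : Fin 5 → ℂ) c
      map_add' := fun φ ψ => by funext a; simp [add_mul, sum_add_distrib]
      map_smul' := fun r φ => by funext a; simp [mul_assoc, mul_sum] }
  have hrange : Module.finrank ℂ (LinearMap.range L) ≤ 2 := by
    refine (Submodule.finrank_le _).trans ?_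
    rw [Module.finrank_fintype_fun_eq_card, Fintype.card_coe]; exact hF
  have hsum := L.finrank_range_add_finrank_ker
  have h5 : Module.finrank ℂ (Fin 5 → ℂ) = 5 := by simp
  have hker : 1 < Module.finrank ℂ (LinearMap.ker L) := by omega
  obtain ⟨y, hy⟩ := (Module.finrank_pos_iff_exists_ne_zero (R := ℂ) (M := LinearMap.ker L)).1 (by omega)
  obtain ⟨z, hyz⟩ := exists_linearIndependent_pair_of_one_lt_finrank hker hy
  have hmap := hyz.map' (LinearMap.ker L).subtype (Submodule.ker_subtype _)
  have hfun : (⇑(LinearMap.ker L).subtype ∘ ![y, z]) = ![(y : Fin 5 → ℂ), (z : Fin 5 → ℂ)] := by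
    funext i; fin_cases i <;> rfl
  rw [hfun] at hmap
  have hy0 : ∀ f ∈ F, ∑ c, (y : Fin 5 → ℂ) c * f c = 0 := fun f hf => by
    have := y.2; rw [LinearMap.mem_ker] at this; exact congrFun this ⟨f, hf⟩
  have hz0 : ∀ f ∈ F, ∑ c, (z : Fin 5 → ℂ) c * f c = 0 := fun f hf => by
    have := z.2; rw [LinearMap.mem_ker] at this; exact congrFun this ⟨f, hf⟩
  exact ⟨y, z, hmap, hy0, hz0⟩

/-! ### §4 The core: slices concentrated on slot `0` -/

/-- **Core.**  Slices `f_k(v_0) G_k(v)` (`k < c`, `G_k` blind to slot `0`) and at most two further slices `g_i(v_{s i}) H_i(v)` at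
slots `s i ≠ 0` (`i < r`, `r ≤ 2`, `c + r ≤ 4`) never sum to the `3 × 5` injective pattern. -/
theorem core {c r : ℕ} (hr : r ≤ 2) (hcr : c + r ≤ 4)
    (f : Fin c → Fin 5 → ℂ) (G : Fin c → (Fin 3 → Fin 5) → ℂ)
    (hG : ∀ k, ∀ v v' : Fin 3 → Fin 5, (∀ j, j ≠ 0 → v j = v' j) → G k v = G k v')
    (s : Fin r → Fin 3) (hs : ∀ i, s i ≠ 0) (g : Fin r → Fin 5 → ℂ) (H : Fin r → (Fin 3 → Fin 5) → ℂ)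
    (hH : ∀ i, ∀ v v' : Fin 3 → Fin 5, (∀ j, j ≠ s i → v j = v' j) → H i v = H i v')
    (hsum : ∀ v : Fin 3 → Fin 5, (if Function.Injective v then (1 : ℂ) else 0) =
      (∑ k, f k (v 0) * G k v) + ∑ i, g i (v (s i)) * H i v) : False := by
  classical
  -- the contraction identity: for `x ⊥ {f_k}`, `M(x)(b,c) = Σ_i (rank-one)_i(b,c)`
  have key : ∀ x : Fin 5 → ℂ, (∀ k, ∑ a, x a * f k a = 0) → ∀ b c' : Fin 5,
      (if b = c' then (0 : ℂ) else (∑ a, x a) - x b - x c') =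
        ∑ i, ∑ a, x a * (g i (![a, b, c'] (s i)) * H i ![a, b, c']) := by
    intro x hx b c'
    rw [← contract_pattern3 x b c']
    have : ∀ a, x a * (if Function.Injective ![a, b, c'] then (1 : ℂ) else 0) =
        (∑ k, x a * (f k a * G k ![a, b, c'])) + ∑ i, x a * (g i (![a, b, c'] (s i)) * H i ![a, b, c']) := by
      intro a
      rw [hsum ![a, b, c'], mul_add, mul_sum, mul_sum]
      simp
    simp only [this, sum_add_distrib]
    rw [sum_comm, sum_comm (f := fun a i => x a * (g i (![a, b, c'] (s i)) * H i ![a, b, c']))]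
    have hzero : ∑ k, ∑ a, x a * (f k a * G k ![a, b, c']) = 0 := by
      refine sum_eq_zero fun k _ => ?_
      have hGk : ∀ a, G k ![a, b, c'] = G k ![0, b, c'] := fun a =>
        hG k _ _ (fun j hj => by fin_cases j <;> simp_all)
      simp only [hGk]
      have : ∑ a, x a * (f k a * G k ![0, b, c']) = (∑ a, x a * f k a) * G k ![0, b, c'] := by
        rw [sum_mul]; exact sum_congr rfl fun a _ => by ring
      rw [this, hx k, zero_mul]
    rw [hzero, zero_add]
  -- case analysis on `r`
  rcases Nat.lt_or_ge r 1 with hr0 | hr1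
  · -- r = 0 : `M(x) = 0` on the kernel, which is non-zero
    have hr0' : r = 0 := by omega
    subst hr0'
    obtain ⟨x, hx0, hx⟩ := LaplaceTriangular.exists_ne_zero_orthogonal (univ.image f)
      (lt_of_le_of_lt card_image_le (by simp; omega))
    have hxf : ∀ k, ∑ a, x a * f k a = 0 := fun k => hx (f k) (mem_image_of_mem f (mem_univ k))
    have hM : ∀ b c' : Fin 5, b ≠ c' → (∑ a, x a) - x b - x c' = 0 := by
      intro b c' hbc
      have := key x hxf b c'
      rw [if_neg hbc] at this
      rw [this]
      simp
    exact hx0 (Pencil5.pencil5_eq_zero x hM)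
  rcases Nat.lt_or_ge r 2 with hr2 | hr2
  · -- r = 1 : `M(x)` is one rank-one matrix on the kernel, hence `0`, hence `x = 0`
    have hr1' : r = 1 := by omega
    subst hr1'
    obtain ⟨x, hx0, hx⟩ := LaplaceTriangular.exists_ne_zero_orthogonal (univ.image f)
      (lt_of_le_of_lt card_image_le (by simp; omega))
    have hxf : ∀ k, ∑ a, x a * f k a = 0 := fun k => hx (f k) (mem_image_of_mem f (mem_univ k))
    obtain ⟨p, q, hpq⟩ := contract_other_slice x (g 0) (H 0) (s 0) (hs 0) (hH 0)
    have hM : ∀ b c' : Fin 5, (if b = c' then (0 : ℂ) else (∑ a, x a) - x b - x c') = p b * q c' := by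
      intro b c'
      rw [key x hxf b c', Fin.sum_univ_one, hpq]
    have hzero := Pencil5.symm_rank_one_eq_zero' (fun b c' => if b = c' then (0 : ℂ) else (∑ a, x a) - x b - x c') p q
      (fun b c' => by
        by_cases h : b = c'
        · subst h; rfl
        · rw [if_neg h, if_neg (Ne.symm h)]; ring)
      (fun b => by simp) hM
    refine hx0 (Pencil5.pencil5_eq_zero x fun b c' hbc => ?_)
    have := hzero b c'
    rwa [if_neg hbc] at this
  · -- r = 2 : two rank-one matrices on a kernel of dimension ≥ 3 — a plane inside the fifteen lines
    have hr2' : r = 2 := by omega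
    subst hr2'
    have hc2 : c ≤ 2 := by omega
    obtain ⟨x, x', hind, hx, hx'⟩ := exists_indep_pair (univ.image f) (card_image_le.trans (by simp; omega))
    refine Pencil5.pencil5_plane_not_two_rank_one x x' hind fun μ => ?_
    set y : Fin 5 → ℂ := x + μ • x' with hy
    have hyf : ∀ k, ∑ a, y a * f k a = 0 := by
      intro k
      have e1 := hx (f k) (mem_image_of_mem f (mem_univ k))
      have e2 := hx' (f k) (mem_image_of_mem f (mem_univ k))
      have : ∑ a, y a * f k a = (∑ a, x a * f k a) + μ * ∑ a, x' a * f k a := by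
        rw [mul_sum, ← sum_add_distrib]
        refine sum_congr rfl fun a _ => ?_
        simp only [hy, Pi.add_apply, Pi.smul_apply, smul_eq_mul]; ring
      rw [this, e1, e2]; simp
    obtain ⟨p, q, hpq⟩ := contract_other_slice y (g 0) (H 0) (s 0) (hs 0) (hH 0)
    obtain ⟨p', q', hpq'⟩ := contract_other_slice y (g 1) (H 1) (s 1) (hs 1) (hH 1)
    refine ⟨p, q, p', q', fun b c' => ?_⟩
    rw [key y hyf b c', Fin.sum_univ_two, hpq, hpq']

/-! ### §5 Slice rank five -/

/-- Injectivity is invariant under a permutation of the three slots. -/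
theorem injective_comp_perm3_iff (σ : Equiv.Perm (Fin 3)) (v : Fin 3 → Fin 5) :
    Function.Injective (v ∘ σ) ↔ Function.Injective v :=
  ⟨fun h => by
    have := h.comp σ.symm.injective
    simpa [Function.comp_assoc] using this,
   fun h => h.comp σ.injective⟩

/-- **The `3 × 5` injective pattern has slice rank `5`.**  In the data format of `LaplaceOptimal`: if split-rank-one terms with
`|S_t| ∈ {1, 2}` sum to `[v injective]` on `Fin 3 → Fin 5`, there are at least five of them. -/
theorem slice_rank_three_five {N : ℕ} (T : Finset (Fin N)) (S : Fin N → Finset (Fin 3))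
    (u w : Fin N → (Fin 3 → Fin 5) → ℂ)
    (hu : ∀ t, ∀ v v' : Fin 3 → Fin 5, (∀ i ∈ S t, v i = v' i) → u t v = u t v')
    (hw : ∀ t, ∀ v v' : Fin 3 → Fin 5, (∀ i, i ∉ S t → v i = v' i) → w t v = w t v')
    (hsum : ∀ v : Fin 3 → Fin 5, (∑ t ∈ T, u t v * w t v) = if Function.Injective v then 1 else 0)
    (hS : ∀ t ∈ T, (S t).card = 1 ∨ (S t).card = 2) : 5 ≤ T.card := by
  classical
  by_contra hlt
  push Not at hlt
  -- normal forms of the terms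
  have key : ∀ x : T, ∃ (s : Fin 3) (f : Fin 5 → ℂ) (G : (Fin 3 → Fin 5) → ℂ),
      (∀ v v' : Fin 3 → Fin 5, (∀ j, j ≠ s → v j = v' j) → G v = G v') ∧ ∀ v, u x v * w x v = f (v s) * G v :=
    fun x => slice_normal_form3 (S x) (u x) (w x) (hu x) (hw x) (hS x x.2)
  choose sl f G hGb hterm using key
  -- the slot carrying the most slices
  obtain ⟨j₀, -, hmax⟩ := exists_max_image (univ : Finset (Fin 3))
    (fun j => (univ.filter (fun x : T => sl x = j)).card) univ_nonempty
  set A := univ.filter (fun x : T => sl x = j₀) with hA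
  set B := univ.filter (fun x : T => sl x ≠ j₀) with hB
  have hAB : A.card + B.card = T.card := by
    rw [hA, hB, Finset.card_filter_add_card_filter_not, card_univ, Fintype.card_coe]
  have hBle : B.card ≤ 2 := by
    -- `B` splits over the two other slots, each carrying at most `|A|` slices
    by_contra hB3
    push Not at hB3
    have hsplit : B.card ≤ ∑ j ∈ (univ : Finset (Fin 3)).erase j₀, (univ.filter (fun x : T => sl x = j)).card := by
      have : B = ((univ : Finset (Fin 3)).erase j₀).biUnion (fun j => univ.filter (fun x : T => sl x = j)) := by
        ext x
        simp only [hB, mem_filter, mem_univ, true_and, mem_biUnion, mem_erase]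
        exact ⟨fun h => ⟨sl x, ⟨h, trivial⟩, rfl⟩, fun ⟨j, ⟨hj, _⟩, hx⟩ => hx ▸ hj⟩
      rw [this]
      exact card_biUnion_le
    have hle : B.card ≤ ∑ j ∈ (univ : Finset (Fin 3)).erase j₀, A.card :=
      hsplit.trans (sum_le_sum fun j _ => hmax j (mem_univ j))
    rw [sum_const, card_erase_of_mem (mem_univ j₀), card_univ, Fintype.card_fin] at hle
    norm_num at hle
    omega
  -- index `A` by `Fin c` and `B` by `Fin r`
  set c := A.card with hc
  set r := B.card with hr
  have hcr : c + r ≤ 4 := by omega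
  let eA : A ≃ Fin c := Fintype.equivFinOfCardEq (by rw [Fintype.card_coe])
  let eB : B ≃ Fin r := Fintype.equivFinOfCardEq (by rw [Fintype.card_coe])
  -- slot transport: put `j₀` first
  let σ : Equiv.Perm (Fin 3) := Equiv.swap 0 j₀
  have hσj : σ j₀ = 0 := by simp [σ]
  -- the transported identity in array form
  refine core (c := c) (r := r) hBle hcr
    (fun k => f (eA.symm k)) (fun k v => G (eA.symm k) (v ∘ σ)) ?_
    (fun i => σ (sl (eB.symm i))) ?_ (fun i => f (eB.symm i)) (fun i v => G (eB.symm i) (v ∘ σ)) ?_ ?_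
  · -- `G_k` blind to slot `0` after transport
    intro k v v' hvv'
    refine hGb _ _ _ (fun j hj => ?_)
    have hslot : sl (eA.symm k) = j₀ := by
      have hmem : ((eA.symm k : A) : T) ∈ univ.filter (fun x : T => sl x = j₀) := (eA.symm k).2
      exact (mem_filter.mp hmem).2
    simp only [Function.comp_apply]
    refine hvv' (σ j) (fun h => hj ?_)
    have : j = σ.symm 0 := by rw [← h]; simp
    rw [this, hslot]; simp [σ]
  · -- the other slices sit at slots `≠ 0`
    intro i h0
    have hslot : sl (eB.symm i) ≠ j₀ := by
      have hmem : ((eB.symm i : B) : T) ∈ univ.filter (fun x : T => sl x ≠ j₀) := (eB.symm i).2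
      exact (mem_filter.mp hmem).2
    apply hslot
    have := congrArg σ.symm h0
    simpa [σ, Equiv.swap_apply_left] using this
  · -- `H_i` blind to its slot after transport
    intro i v v' hvv'
    refine hGb _ _ _ (fun j hj => ?_)
    simp only [Function.comp_apply]
    refine hvv' (σ j) (fun h => hj ?_)
    have := congrArg σ.symm h
    simpa using this
  · -- the identity
    intro v
    have H0 : (if Function.Injective v then (1 : ℂ) else 0) = ∑ t ∈ T, u t (v ∘ σ) * w t (v ∘ σ) := by
      rw [hsum]
      by_cases hv : Function.Injective v
      · rw [if_pos hv, if_pos ((injective_comp_perm3_iff σ v).mpr hv)]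
      · rw [if_neg hv, if_neg (fun h => hv ((injective_comp_perm3_iff σ v).mp h))]
    rw [H0, ← sum_coe_sort T]
    have hsplitsum : ∑ x : T, u x (v ∘ σ) * w x (v ∘ σ) =
        (∑ x ∈ A, u x (v ∘ σ) * w x (v ∘ σ)) + ∑ x ∈ B, u x (v ∘ σ) * w x (v ∘ σ) := by
      rw [hA, hB, sum_filter_add_sum_filter_not]
    rw [hsplitsum]
    congr 1
    · rw [← sum_coe_sort A]
      refine (Fintype.sum_equiv eA _ _ (fun x => ?_))
      simp only [Equiv.symm_apply_apply, hterm, Function.comp_apply]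
      have hslot : sl x = j₀ := by
        have hmem : ((x : A) : T) ∈ univ.filter (fun x : T => sl x = j₀) := x.2
        exact (mem_filter.mp hmem).2
      rw [hslot, hσj]
    · rw [← sum_coe_sort B]
      refine (Fintype.sum_equiv eB _ _ (fun x => ?_))
      simp only [Equiv.symm_apply_apply, hterm, Function.comp_apply]

end ThreeFive

end Summit.ValiantsHypothesis.ValiantsHypothesis.Theorems.RigidityForcesSymmetryRankRigidMinimalRepr
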